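import Summits.QuantumFields.YangMills.Theorems.BalabanUVNodesN15ContourSums
import Summits.QuantumFields.YangMills.Theorems.BalabanUVNodesN15OrderedProducts
import HarnessLib

/-!
# Route «BalabanUVNodes» (K4 «SpineRates»), node N15 = NE2 — THE ORDERED CONTOUR PRODUCTS `Π_{b ∈ Γ_{y,x}} exp X(b)` (the parallel transport along the
# staircase contour, at `U ≡ 1`) AND THEIR TWO-SPACING FIT THROUGH KING's PAIRING: each coarse factor `exp(L^m·X̃(b))` IS the ordered product of the `L^m`
# equal fine-step factors `exp X̃(b)` over the fine bonds above `b`, so the fine and the refined coarse products differ factor by factor (Duhamel–Lipschitz) plus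
# `< L^m` trailing factors per leg — no Baker–Campbell–Hausdorff term

Cell `pub-ymgap`, seat `pub-ymgap-dag-n15-c` (generation g4; R134 ACCELERATION SEAT, strategy s1 «first missing estimate»; HUMAN RULING D-0062; chair R424 venue;
`bears_on: R4∕N15`).  Filed `--supports stmt-QuantumFields-19908 --as helper` (K3′; helper).  Imports BY NAME, nothing in the tree modified: this seat's
`…N15OrderedProducts` (`oprod` and its lemmas), `…N15ContourSums` (`stair`, `blockCoords`, `hdig`, `tidx`, `kingPrV_bpt_stair_tidx`, `kingPr_bpt_hdig`; through it b05 `bpt`∕`bpt_bijective`, n15-a `kingPrV`), n15-b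
13a `…N15ExpLetters` (`norm_exp_sub_exp_le`) and `Literature.Analysis.Calculus.ExpDuhamel` (`norm_exp_sub_one_le`) through the lineage, Mathlib `NormedSpace.exp_nsmul`.

WHY.  The print's `F′₂ⱼ(A; y, x)` ([Balaban1985BackgroundPropagators] (3.55)–(3.58) pp. 401–402) is built from the PARALLEL TRANSPORTS `(U′U)(Γ_{y,x})` along
the staircase contours; at `U ≡ 1`, in the adjoint representation, this is the ORDERED PRODUCT `Π_b exp(η·ad A′(b))` (its first-order part `η·Σ_b ad A′(b)` is
`…N15ContourSums`; the ordered-product bookkeeping `oprod`, `norm_oprod_sub_one_le`, `norm_oprod_sub_oprod_le` is `…N15OrderedProducts`).  §2 `stairProd X y a ν = Π_μ Π_{t<a_μ} exp X_μ(b_{μ,t})`,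
`lineProd`, `norm_stairProd_sub_one_le`, `norm_lineProd_sub_one_le`; §3 THE TWO-SPACING FIT: fine exponent field `X′` (level `L^mL^k`),
coarse PER-FINE-STEP field `X̃` (level `L^k`; coarse factor `exp(L^m•X̃(b)) = (exp X̃(b))^{L^m}`, `exp_natCast_smul`), `‖X′‖, ‖X̃‖ ≤ ρ`, `ρ·L^mL^k ≤ 1`, pointwise fit
`‖X′(b′) − X̃(pr b′)‖ ≤ ω`: `legProd_coarse_eq` (THE COARSE LEG REFINES), ★ `norm_legProd_two_spacing_le`, ★ **`norm_stairProd_two_spacing_le`**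
(`≤ 3^{d+1}(d+1)·(36·L^mL^k·ω + 9·L^m·ρ)`; the `lineProd` form is in the sequel).  For Bałaban's `X′ = η′·ad A′`, `X̃ = η′·ad Ā`: `ρ = 2η′·cMα₀`, `L^mL^kω ≤ 2C_πcMα₀η′`,
`L^mρ = 2η·cMα₀` — both `O(θ_j·cMα₀)`; the sequel builds the one-level parallel-transport species from it.

HONEST FRAMING ∕ LIMITS.  Elementary Banach-algebra bookkeeping on b05's torus blocks; the contour is the one-level coordinate-ordered staircase from the block's
base point (our reading of [5]'s `Γ_{y,x}`), NOT the multi-level contour of (3.55); `U ≡ 1` (no `U(b)` factors, no rotations `R(·)`); crude absolute constants.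
Count-neutral (typed 28∕28 · discharged unchanged); NOT a discharge of N15; one finite T⁴ at fixed ε — NOT infinite volume, NOT OS on ℝ⁴, NOT a mass gap, NOT Clay.
-/

noncomputable section

open scoped BigOperators
open Finset NormedSpace

namespace Summit.QuantumFields.YangMills.BalabanUVNodes.N15.VectorPiece

open Literature.MathematicalPhysics.QuantumFieldTheory.Balaban1983to89
open Literature.MathematicalPhysics.QuantumFieldTheory.Balaban1983to89.B5Prop11Plancherel (Tor fine)
open Literature.MathematicalPhysics.QuantumFieldTheory.Balaban1983to89.B5Block118 (bpt)
open Literature.MathematicalPhysics.QuantumFieldTheory.Balaban1983to89.B7Prop6Bound (oprod)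
open Literature.MathematicalPhysics.QuantumFieldTheory.Balaban1983to89.B5Blocks16 (bpt_bijective)
open Literature.Analysis.Calculus (norm_exp_sub_one_le)
open Summit.QuantumFields.YangMills.BalabanUVNodes.N15.MatrixSpecies (norm_exp_sub_exp_le)

variable {d : ℕ}

/-! ## §2 The staircase product (parallel transport along the contour at `U ≡ 1`) -/

section Stair

variable {𝔸 : Type} [NormedRing 𝔸] [NormedAlgebra ℝ 𝔸] [CompleteSpace 𝔸]
variable (n : ℕ) [NeZero n] (M : Fin (d + 1) → ℕ) [∀ μ, NeZero (M μ)]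

/-- The bond of leg `μ` at (natural) height `t` of the staircase to `n·y + a`, component `ν` (height clamped into `[0, n)`; only `t < a_μ` is used). [folklore] -/
def bondAt (y : Tor M) (a : Fin (d + 1) → Fin n) (μ ν : Fin (d + 1)) (t : ℕ) : Tor (fine n M) × Fin (d + 1) :=
  (bpt n M y (stair a μ ⟨t % n, Nat.mod_lt _ (Nat.pos_of_ne_zero (NeZero.ne n))⟩), ν)

omit [∀ μ, NeZero (M μ)] in
/-- Below `n` the clamp is invisible. [folklore] -/
theorem bondAt_of_lt (y : Tor M) (a : Fin (d + 1) → Fin n) (μ ν : Fin (d + 1)) (t : Fin n) :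
    bondAt n M y a μ ν t = (bpt n M y (stair a μ t), ν) := by
  have : (⟨(t : ℕ) % n, Nat.mod_lt _ (Nat.pos_of_ne_zero (NeZero.ne n))⟩ : Fin n) = t := Fin.ext (Nat.mod_eq_of_lt t.isLt)
  simp [bondAt, this]

/-- THE LEG PRODUCT `Π_{t < a_μ} exp X_μ(b_{μ,t})`. [cite: Balaban1985BackgroundPropagators, (3.55)–(3.57) p.401 («U(Γ_{y,x})»: shape)] -/
def legProd (X : Fin (d + 1) → Tor (fine n M) × Fin (d + 1) → 𝔸) (y : Tor M) (a : Fin (d + 1) → Fin n) (μ ν : Fin (d + 1)) : 𝔸 :=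
  oprod (fun t => exp (X μ (bondAt n M y a μ ν t))) (a μ)

/-- THE STAIRCASE PRODUCT: the legs in coordinate order. [cite: Balaban1985BackgroundPropagators, (3.55)–(3.57) p.401 (shape)] -/
def stairProd (X : Fin (d + 1) → Tor (fine n M) × Fin (d + 1) → 𝔸) (y : Tor M) (a : Fin (d + 1) → Fin n) (ν : Fin (d + 1)) : 𝔸 :=
  oprod (fun i => if h : i < d + 1 then legProd n M X y a ⟨i, h⟩ ν else 1) (d + 1)

/-- THE CONTOUR PRODUCT at a carrier point. [cite: Balaban1985BackgroundPropagators, (3.55)–(3.57) p.401 (shape)] -/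
def lineProd (X : Fin (d + 1) → Tor (fine n M) × Fin (d + 1) → 𝔸) (p : Tor (fine n M) × Fin (d + 1)) : 𝔸 :=
  stairProd n M X (blockCoords n M p.1).1 (blockCoords n M p.1).2 p.2

omit [NormedAlgebra ℝ 𝔸] [CompleteSpace 𝔸] in
/-- In block coordinates. [folklore] -/
theorem lineProd_bpt (X : Fin (d + 1) → Tor (fine n M) × Fin (d + 1) → 𝔸) (y : Tor M) (a : Fin (d + 1) → Fin n) (ν : Fin (d + 1)) :
    lineProd n M X (bpt n M y a, ν) = stairProd n M X y a ν := by
  simp [lineProd]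

omit [∀ μ, NeZero (M μ)] in
/-- `‖legProd − 1‖ ≤ e^{ρn} − 1` when `‖X‖ ≤ ρ` (`ρ ≥ 0`). [folklore] -/
theorem norm_legProd_sub_one_le {X : Fin (d + 1) → Tor (fine n M) × Fin (d + 1) → 𝔸} {ρ : ℝ} (hρ : 0 ≤ ρ) (hX : ∀ μ b, ‖X μ b‖ ≤ ρ)
    (y : Tor M) (a : Fin (d + 1) → Fin n) (μ ν : Fin (d + 1)) : ‖legProd n M X y a μ ν - 1‖ ≤ Real.exp (ρ * n) - 1 := by
  have h1 := norm_oprod_sub_one_le (F := fun t => exp (X μ (bondAt n M y a μ ν t))) (N := a μ) (κ := Real.exp ρ - 1)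
    (by have := Real.add_one_le_exp ρ; linarith) (fun t _ => (norm_exp_sub_one_le _).trans (sub_le_sub_right (Real.exp_le_exp.2 (hX μ _)) 1))
  refine h1.trans (sub_le_sub_right ?_ 1)
  rw [add_sub_cancel, ← Real.exp_nat_mul, mul_comm]
  exact Real.exp_le_exp.2 (mul_le_mul_of_nonneg_left (by exact_mod_cast (a μ).isLt.le) hρ)

omit [∀ μ, NeZero (M μ)] in
/-- `‖stairProd − 1‖ ≤ e^{ρn(d+1)} − 1`. [folklore] -/
theorem norm_stairProd_sub_one_le {X : Fin (d + 1) → Tor (fine n M) × Fin (d + 1) → 𝔸} {ρ : ℝ} (hρ : 0 ≤ ρ) (hX : ∀ μ b, ‖X μ b‖ ≤ ρ)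
    (y : Tor M) (a : Fin (d + 1) → Fin n) (ν : Fin (d + 1)) : ‖stairProd n M X y a ν - 1‖ ≤ Real.exp (ρ * n * (d + 1)) - 1 := by
  have hκ : 0 ≤ Real.exp (ρ * n) - 1 := by have := Real.add_one_le_exp (ρ * n); nlinarith [mul_nonneg hρ (Nat.cast_nonneg n)]
  have h1 := norm_oprod_sub_one_le (F := fun i => if h : i < d + 1 then legProd n M X y a ⟨i, h⟩ ν else 1) (N := d + 1)
    (κ := Real.exp (ρ * n) - 1) hκ (fun i hi => by rw [dif_pos hi]; exact norm_legProd_sub_one_le n M hρ hX y a _ ν)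
  refine h1.trans (le_of_eq ?_)
  rw [add_sub_cancel, ← Real.exp_nat_mul, show ((d + 1 : ℕ) : ℝ) * (ρ * n) = ρ * n * (d + 1) by push_cast; ring]

/-- `‖lineProd − 1‖ ≤ e^{ρn(d+1)} − 1`. [folklore] -/
theorem norm_lineProd_sub_one_le {X : Fin (d + 1) → Tor (fine n M) × Fin (d + 1) → 𝔸} {ρ : ℝ} (hρ : 0 ≤ ρ) (hX : ∀ μ b, ‖X μ b‖ ≤ ρ)
    (p : Tor (fine n M) × Fin (d + 1)) : ‖lineProd n M X p - 1‖ ≤ Real.exp (ρ * n * (d + 1)) - 1 :=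
  norm_stairProd_sub_one_le n M hρ hX _ _ _

end Stair

/-! ## §3 Two spacings: the coarse factors refine into `L^m` equal fine-step factors -/

section TwoSpacings

variable {𝔸 : Type} [NormedRing 𝔸] [NormedAlgebra ℝ 𝔸] [CompleteSpace 𝔸]
variable (L k m : ℕ) [NeZero L] (M : Fin (d + 1) → ℕ) [∀ μ, NeZero (M μ)]

omit [NeZero L] [∀ μ, NeZero (M μ)] in
/-- `exp(n•Z) = (exp Z)^n` for a natural `n` read in `ℝ` (Mathlib's `exp_nsmul` asks for a `ℚ`-algebra structure; here from `exp_add_of_commute_of_mem_ball` over `ℝ`,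
radius `∞`). [folklore] -/
theorem exp_natCast_smul (Z : 𝔸) (n : ℕ) : exp (((n : ℕ) : ℝ) • Z) = exp Z ^ n := by
  have hball : ∀ W : 𝔸, W ∈ Metric.eball (0 : 𝔸) (expSeries ℝ 𝔸).radius := fun W => by
    rw [expSeries_radius_eq_top]; exact Metric.mem_eball.2 (edist_lt_top _ _)
  induction n with
  | zero => simp
  | succ n ih =>
    rw [Nat.cast_succ, add_smul, one_smul, exp_add_of_commute_of_mem_ball ((Commute.refl Z).smul_left _) (hball _) (hball _), ih, pow_succ]

/-- THE PROJECTION OF THE FINE BONDS (natural heights): for `s < L^k`, `j < L^m`, King's pairing sends the fine staircase bond at height `L^m·s + j` to the coarse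
staircase bond at height `s`. [cite: King1986, p.664 («x′ ∈ B^n(x)»)] -/
theorem kingPrV_bondAt (y : Tor M) (a' : Fin (d + 1) → Fin (L ^ m * L ^ k)) (μ ν : Fin (d + 1)) (s : Fin (L ^ k)) (j : Fin (L ^ m)) :
    kingPrV L k m M (bondAt (L ^ m * L ^ k) M y a' μ ν (s * L ^ m + j)) = bondAt (L ^ k) M y (hdig L k m a') μ ν s := by
  have ht : (s : ℕ) * L ^ m + j = (tidx L k m s j : ℕ) := by rw [tidx_val, mul_comm]
  have h1 : bondAt (L ^ m * L ^ k) M y a' μ ν (s * L ^ m + j) = (bpt (L ^ m * L ^ k) M y (stair a' μ (tidx L k m s j)), ν) := by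
    rw [ht]; exact bondAt_of_lt _ M y a' μ ν (tidx L k m s j)
  rw [h1, kingPrV_bpt_stair_tidx, ← bondAt_of_lt]

/-- **THE COARSE LEG REFINES**: with the coarse exponent `L^m • X̃` (so each coarse factor is `(exp X̃)^{L^m}`), the coarse leg product up to height `h = ⌊a′_μ∕L^m⌋`
IS the ordered product over the fine heights `t′ < h·L^m` of `exp X̃(pr b′_{t′})`. [folklore] -/
theorem legProd_coarse_eq (Xt : Fin (d + 1) → Tor (fine (L ^ k) M) × Fin (d + 1) → 𝔸) (y : Tor M) (a' : Fin (d + 1) → Fin (L ^ m * L ^ k))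
    (μ ν : Fin (d + 1)) :
    legProd (L ^ k) M (fun μ b => ((L ^ m : ℕ) : ℝ) • Xt μ b) y (hdig L k m a') μ ν =
      oprod (fun t' => exp (Xt μ (kingPrV L k m M (bondAt (L ^ m * L ^ k) M y a' μ ν t')))) ((hdig L k m a' μ : ℕ) * L ^ m) := by
  unfold legProd
  rw [← oprod_blocks]
  refine oprod_congr fun s hs => ?_
  have hsF : s < L ^ k := lt_trans hs (hdig L k m a' μ).isLt
  dsimp only
  rw [exp_natCast_smul, ← oprod_const]
  refine oprod_congr fun j hj => ?_
  have key := kingPrV_bondAt L k m M y a' μ ν ⟨s, hsF⟩ ⟨j, hj⟩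
  simp only at key
  rw [key]

/-- **THE TWO-SPACING FIT OF ONE LEG.**  `‖X′‖, ‖X̃‖ ≤ ρ` with `0 ≤ ρ`, `ρ·(L^mL^k) ≤ 1`; pointwise fit `‖X′(b′) − X̃(pr b′)‖ ≤ ω` (`ω ≥ 0`).  Then
`‖legProd′ X′ y a′ μ ν − legProd (L^m•X̃) y (hdig a′) μ ν‖ ≤ 36·(L^mL^k)·ω + 9·(L^m·ρ)` — factorwise Duhamel–Lipschitz over the `≤ L^mL^k` projected fine bonds,
plus the `< L^m` trailing fine factors. [cite: Balaban1985BackgroundPropagators, (3.57)–(3.58) pp.401–402 (shape); King1986, p.664] -/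
theorem norm_legProd_two_spacing_le {X' : Fin (d + 1) → Tor (fine (L ^ m * L ^ k) M) × Fin (d + 1) → 𝔸}
    {Xt : Fin (d + 1) → Tor (fine (L ^ k) M) × Fin (d + 1) → 𝔸} {ρ ω : ℝ} (hρ : 0 ≤ ρ) (hω : 0 ≤ ω) (hρn : ρ * ((L ^ m * L ^ k : ℕ) : ℝ) ≤ 1)
    (hX' : ∀ μ b, ‖X' μ b‖ ≤ ρ) (hXt : ∀ μ b, ‖Xt μ b‖ ≤ ρ) (hfit : ∀ μ b', ‖X' μ b' - Xt μ (kingPrV L k m M b')‖ ≤ ω)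
    (y : Tor M) (a' : Fin (d + 1) → Fin (L ^ m * L ^ k)) (μ ν : Fin (d + 1)) :
    ‖legProd (L ^ m * L ^ k) M X' y a' μ ν - legProd (L ^ k) M (fun μ b => ((L ^ m : ℕ) : ℝ) • Xt μ b) y (hdig L k m a') μ ν‖ ≤
      36 * ((L ^ m * L ^ k : ℕ) : ℝ) * ω + 9 * (((L ^ m : ℕ) : ℝ) * ρ) := by
  -- notation: `n′ = L^mL^k` fine level, `h = ⌊a′_μ∕L^m⌋` the digit, `F`∕`G` the fine ∕ refined-coarse factors
  set F : ℕ → 𝔸 := fun t' => exp (X' μ (bondAt (L ^ m * L ^ k) M y a' μ ν t')) with hF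
  set G : ℕ → 𝔸 := fun t' => exp (Xt μ (kingPrV L k m M (bondAt (L ^ m * L ^ k) M y a' μ ν t'))) with hG
  have hLm1 : 1 ≤ L ^ m := Nat.one_le_pow _ _ (Nat.pos_of_ne_zero (NeZero.ne L))
  have hLk1 : 1 ≤ L ^ k := Nat.one_le_pow _ _ (Nat.pos_of_ne_zero (NeZero.ne L))
  have hn'0 : (0 : ℝ) ≤ ((L ^ m * L ^ k : ℕ) : ℝ) := Nat.cast_nonneg _
  have hLm0 : (0 : ℝ) ≤ ((L ^ m : ℕ) : ℝ) := Nat.cast_nonneg _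
  have hLmn : ((L ^ m : ℕ) : ℝ) ≤ ((L ^ m * L ^ k : ℕ) : ℝ) := by exact_mod_cast Nat.le_mul_of_pos_right _ (by omega)
  have hn'1 : (1 : ℝ) ≤ ((L ^ m * L ^ k : ℕ) : ℝ) := le_trans (by exact_mod_cast hLm1) hLmn
  have hρ1 : ρ ≤ 1 := by nlinarith
  -- splitting the fine leg at `h·L^m ≤ a′_μ`
  have hhm : (hdig L k m a' μ : ℕ) * L ^ m ≤ (a' μ : ℕ) := by
    show (a' μ : ℕ) / L ^ m * L ^ m ≤ a' μ; exact Nat.div_mul_le_self _ _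
  have hrem : (a' μ : ℕ) - (hdig L k m a' μ : ℕ) * L ^ m < L ^ m := by
    show (a' μ : ℕ) - (a' μ : ℕ) / L ^ m * L ^ m < L ^ m
    have h1 := Nat.div_add_mod' (a' μ : ℕ) (L ^ m)
    have h2 := Nat.mod_lt (a' μ : ℕ) (show 0 < L ^ m by omega)
    generalize (a' μ : ℕ) / L ^ m * L ^ m = P at h1 ⊢
    generalize (a' μ : ℕ) % L ^ m = R at h1 h2 ⊢
    omega
  have hsplit : legProd (L ^ m * L ^ k) M X' y a' μ ν =
      oprod F ((hdig L k m a' μ : ℕ) * L ^ m) * oprod (fun i => F ((hdig L k m a' μ : ℕ) * L ^ m + i)) ((a' μ : ℕ) - (hdig L k m a' μ : ℕ) * L ^ m) := by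
    unfold legProd; rw [← oprod_add, Nat.add_sub_cancel' hhm]
  have hcoarse : legProd (L ^ k) M (fun μ b => ((L ^ m : ℕ) : ℝ) • Xt μ b) y (hdig L k m a') μ ν = oprod G ((hdig L k m a' μ : ℕ) * L ^ m) :=
    legProd_coarse_eq L k m M Xt y a' μ ν
  -- factor sizes
  have hκ0 : 0 ≤ Real.exp ρ - 1 := by have := Real.add_one_le_exp ρ; linarith
  have hFk : ∀ i, ‖F i - 1‖ ≤ Real.exp ρ - 1 := fun i => (norm_exp_sub_one_le _).trans (sub_le_sub_right (Real.exp_le_exp.2 (hX' μ _)) 1)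
  have hGk : ∀ i, ‖G i - 1‖ ≤ Real.exp ρ - 1 := fun i => (norm_exp_sub_one_le _).trans (sub_le_sub_right (Real.exp_le_exp.2 (hXt μ _)) 1)
  have hFG : ∀ i, ‖F i - G i‖ ≤ Real.exp ρ * ω := fun i =>
    (norm_exp_sub_exp_le (hX' μ _) (hXt μ _)).trans (mul_le_mul_of_nonneg_left (hfit μ _) (Real.exp_nonneg _))
  -- the three pieces
  have hP : ‖oprod F ((hdig L k m a' μ : ℕ) * L ^ m) - oprod G ((hdig L k m a' μ : ℕ) * L ^ m)‖ ≤
      ((L ^ m * L ^ k : ℕ) : ℝ) * (Real.exp ρ * ω) * Real.exp (ρ * ((L ^ m * L ^ k : ℕ) : ℝ)) := by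
    have h1 := norm_oprod_sub_oprod_le hκ0 (N := (hdig L k m a' μ : ℕ) * L ^ m) (fun i _ => hFk i) (fun i _ => hGk i)
    rw [add_sub_cancel, ← Real.exp_nat_mul] at h1
    refine h1.trans ?_
    have hcnt : ((hdig L k m a' μ : ℕ) * L ^ m : ℕ) ≤ L ^ m * L ^ k := hhm.trans (a' μ).isLt.le
    have hsum : ∑ i ∈ Finset.range ((hdig L k m a' μ : ℕ) * L ^ m), ‖F i - G i‖ ≤ ((L ^ m * L ^ k : ℕ) : ℝ) * (Real.exp ρ * ω) :=
      (Finset.sum_le_sum fun i _ => hFG i).trans (by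
        rw [Finset.sum_const, Finset.card_range, nsmul_eq_mul]
        exact mul_le_mul_of_nonneg_right (by exact_mod_cast hcnt) (mul_nonneg (Real.exp_nonneg _) hω))
    have hexp : Real.exp ((((hdig L k m a' μ : ℕ) * L ^ m : ℕ) : ℝ) * ρ) ≤ Real.exp (ρ * ((L ^ m * L ^ k : ℕ) : ℝ)) :=
      Real.exp_le_exp.2 (by rw [mul_comm]; exact mul_le_mul_of_nonneg_left (by exact_mod_cast hcnt) hρ)
    exact mul_le_mul hsum hexp (Real.exp_nonneg _) (mul_nonneg hn'0 (mul_nonneg (Real.exp_nonneg _) hω))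
  have hT : ‖oprod (fun i => F ((hdig L k m a' μ : ℕ) * L ^ m + i)) ((a' μ : ℕ) - (hdig L k m a' μ : ℕ) * L ^ m) - 1‖ ≤
      Real.exp (ρ * (L ^ m : ℕ)) - 1 := by
    have h1 := norm_oprod_sub_one_le hκ0 (N := (a' μ : ℕ) - (hdig L k m a' μ : ℕ) * L ^ m)
      (F := fun i => F ((hdig L k m a' μ : ℕ) * L ^ m + i)) (fun i _ => hFk _)
    rw [add_sub_cancel, ← Real.exp_nat_mul] at h1
    refine h1.trans (sub_le_sub_right (Real.exp_le_exp.2 ?_) 1)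
    rw [mul_comm]; exact mul_le_mul_of_nonneg_left (by exact_mod_cast hrem.le) hρ
  have hPbar : ‖oprod G ((hdig L k m a' μ : ℕ) * L ^ m) - 1‖ ≤ Real.exp (ρ * ((L ^ m * L ^ k : ℕ) : ℝ)) - 1 := by
    have h1 := norm_oprod_sub_one_le hκ0 (N := (hdig L k m a' μ : ℕ) * L ^ m) (fun i _ => hGk i)
    rw [add_sub_cancel, ← Real.exp_nat_mul] at h1
    refine h1.trans (sub_le_sub_right (Real.exp_le_exp.2 ?_) 1)
    rw [mul_comm]; exact mul_le_mul_of_nonneg_left (by exact_mod_cast (hhm.trans (a' μ).isLt.le)) hρ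
  -- numerics: ρn′ ≤ 1, ρ ≤ 1, L^m ≤ n′
  have he1 : Real.exp (ρ * ((L ^ m * L ^ k : ℕ) : ℝ)) ≤ 3 := (Real.exp_le_exp.2 hρn).trans (by have := Real.exp_one_lt_d9; linarith)
  have he2 : Real.exp ρ ≤ 3 := (Real.exp_le_exp.2 hρ1).trans (by have := Real.exp_one_lt_d9; linarith)
  have hx : ρ * (L ^ m : ℕ) ≤ 1 := (mul_le_mul_of_nonneg_left hLmn hρ).trans hρn
  have he3 : Real.exp (ρ * (L ^ m : ℕ)) - 1 ≤ 3 * (ρ * (L ^ m : ℕ)) := by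
    -- `e^x − 1 ≤ x·e^x ≤ 3x` on `[0, 1]`
    have hx0 : 0 ≤ ρ * (L ^ m : ℕ) := mul_nonneg hρ hLm0
    have hmv : Real.exp (ρ * (L ^ m : ℕ)) - 1 ≤ (ρ * (L ^ m : ℕ)) * Real.exp (ρ * (L ^ m : ℕ)) := by
      have := Real.add_one_le_exp (-(ρ * (L ^ m : ℕ)))
      have hpos := Real.exp_pos (ρ * (L ^ m : ℕ))
      have hmul : Real.exp (-(ρ * (L ^ m : ℕ))) * Real.exp (ρ * (L ^ m : ℕ)) = 1 := by rw [← Real.exp_add]; simp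
      nlinarith
    have hex : Real.exp (ρ * (L ^ m : ℕ)) ≤ 3 := (Real.exp_le_exp.2 hx).trans (by have := Real.exp_one_lt_d9; linarith)
    nlinarith
  -- assemble: P′T − P̄ = (P′ − P̄)T + (P̄T − P̄)
  rw [hsplit, hcoarse]
  set P' := oprod F ((hdig L k m a' μ : ℕ) * L ^ m)
  set Pb := oprod G ((hdig L k m a' μ : ℕ) * L ^ m)
  set T := oprod (fun i => F ((hdig L k m a' μ : ℕ) * L ^ m + i)) ((a' μ : ℕ) - (hdig L k m a' μ : ℕ) * L ^ m)
  have hid : P' * T - Pb = (P' - Pb) + (P' - Pb) * (T - 1) + (Pb * T - Pb) := by noncomm_ring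
  rw [hid]
  have hT0 : 0 ≤ ‖T - 1‖ := norm_nonneg _
  calc ‖(P' - Pb) + (P' - Pb) * (T - 1) + (Pb * T - Pb)‖
      ≤ ‖P' - Pb‖ + ‖P' - Pb‖ * ‖T - 1‖ + ‖Pb * T - Pb‖ := (norm_add₃_le).trans (add_le_add (add_le_add le_rfl (norm_mul_le _ _)) le_rfl)
    _ ≤ ‖P' - Pb‖ + ‖P' - Pb‖ * ‖T - 1‖ + (1 + ‖Pb - 1‖) * ‖T - 1‖ := add_le_add le_rfl (norm_mul_sub_self_le _ _)
    _ ≤ (((L ^ m * L ^ k : ℕ) : ℝ) * (Real.exp ρ * ω) * Real.exp (ρ * ((L ^ m * L ^ k : ℕ) : ℝ))) +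
          (((L ^ m * L ^ k : ℕ) : ℝ) * (Real.exp ρ * ω) * Real.exp (ρ * ((L ^ m * L ^ k : ℕ) : ℝ))) * (3 * (ρ * (L ^ m : ℕ))) +
          (1 + (Real.exp (ρ * ((L ^ m * L ^ k : ℕ) : ℝ)) - 1)) * (3 * (ρ * (L ^ m : ℕ))) := by
        have hA : ‖T - 1‖ ≤ 3 * (ρ * (L ^ m : ℕ)) := hT.trans he3
        refine add_le_add (add_le_add hP (mul_le_mul hP hA hT0 (by positivity))) ?_
        exact mul_le_mul (add_le_add le_rfl hPbar) hA hT0 (by linarith [Real.exp_pos (ρ * ((L ^ m * L ^ k : ℕ) : ℝ))])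
    _ ≤ 36 * ((L ^ m * L ^ k : ℕ) : ℝ) * ω + 9 * (((L ^ m : ℕ) : ℝ) * ρ) := by
        set N : ℝ := ((L ^ m * L ^ k : ℕ) : ℝ) with hN
        set E1 : ℝ := Real.exp ρ with hE1
        set E2 : ℝ := Real.exp (ρ * N) with hE2
        set x : ℝ := ρ * ((L ^ m : ℕ) : ℝ) with hxdef
        have hE2' : 0 ≤ E2 := Real.exp_nonneg _
        have hw : 0 ≤ N * ω := mul_nonneg hn'0 hω
        have hx0 : 0 ≤ x := mul_nonneg hρ hLm0
        have hE12 : E1 * E2 ≤ 9 := by nlinarith [mul_le_mul he2 he1 hE2' (by norm_num : (0:ℝ) ≤ 3)]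
        have h1 : (N * ω) * (E1 * E2) ≤ (N * ω) * 9 := mul_le_mul_of_nonneg_left hE12 hw
        have h2 : (N * ω) * (E1 * E2) * (3 * x) ≤ (N * ω) * 9 * (3 * 1) :=
          mul_le_mul h1 (by linarith) (by positivity) (by positivity)
        have h3 : E2 * (3 * x) ≤ 3 * (3 * x) := mul_le_mul_of_nonneg_right he1 (by positivity)
        have hre : N * (E1 * ω) * E2 + N * (E1 * ω) * E2 * (3 * x) + (1 + (E2 - 1)) * (3 * x) =
            (N * ω) * (E1 * E2) + (N * ω) * (E1 * E2) * (3 * x) + E2 * (3 * x) := by ring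
        rw [hre]
        have hfin : (N * ω) * 9 + (N * ω) * 9 * (3 * 1) + 3 * (3 * x) = 36 * N * ω + 9 * (((L ^ m : ℕ) : ℝ) * ρ) := by rw [hxdef]; ring
        linarith

/-- **THE TWO-SPACING FIT OF THE STAIRCASE PRODUCT**: under the hypotheses of `norm_legProd_two_spacing_le`,
`‖stairProd′ X′ y a′ ν − stairProd (L^m•X̃) y (hdig a′) ν‖ ≤ 3^{d+1}·(d+1)·(36·L^mL^k·ω + 9·L^m·ρ)` — the legs telescoped (each leg `‖· − 1‖ ≤ e^{ρn′} − 1 ≤ 2`).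
[cite: Balaban1985BackgroundPropagators, (3.57)–(3.58) pp.401–402 (shape); King1986, p.664] -/
theorem norm_stairProd_two_spacing_le {X' : Fin (d + 1) → Tor (fine (L ^ m * L ^ k) M) × Fin (d + 1) → 𝔸}
    {Xt : Fin (d + 1) → Tor (fine (L ^ k) M) × Fin (d + 1) → 𝔸} {ρ ω : ℝ} (hρ : 0 ≤ ρ) (hω : 0 ≤ ω) (hρn : ρ * ((L ^ m * L ^ k : ℕ) : ℝ) ≤ 1)
    (hX' : ∀ μ b, ‖X' μ b‖ ≤ ρ) (hXt : ∀ μ b, ‖Xt μ b‖ ≤ ρ) (hfit : ∀ μ b', ‖X' μ b' - Xt μ (kingPrV L k m M b')‖ ≤ ω)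
    (y : Tor M) (a' : Fin (d + 1) → Fin (L ^ m * L ^ k)) (ν : Fin (d + 1)) :
    ‖stairProd (L ^ m * L ^ k) M X' y a' ν - stairProd (L ^ k) M (fun μ b => ((L ^ m : ℕ) : ℝ) • Xt μ b) y (hdig L k m a') ν‖ ≤
      3 ^ (d + 1) * ((d + 1) * (36 * ((L ^ m * L ^ k : ℕ) : ℝ) * ω + 9 * (((L ^ m : ℕ) : ℝ) * ρ))) := by
  have hLm0 : (0 : ℝ) ≤ ((L ^ m : ℕ) : ℝ) := Nat.cast_nonneg _
  have hn'0 : (0 : ℝ) ≤ ((L ^ m * L ^ k : ℕ) : ℝ) := Nat.cast_nonneg _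
  -- both legs are within `e^{ρ n′} − 1 ≤ 2` of `1`
  have he1 : Real.exp (ρ * ((L ^ m * L ^ k : ℕ) : ℝ)) ≤ 3 := (Real.exp_le_exp.2 hρn).trans (by have := Real.exp_one_lt_d9; linarith)
  have hleg' : ∀ μ, ‖legProd (L ^ m * L ^ k) M X' y a' μ ν - 1‖ ≤ 2 := fun μ =>
    (norm_legProd_sub_one_le (L ^ m * L ^ k) M hρ hX' y a' μ ν).trans (by linarith)
  have hρc : ∀ μ b, ‖((L ^ m : ℕ) : ℝ) • Xt μ b‖ ≤ ((L ^ m : ℕ) : ℝ) * ρ := fun μ b => by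
    rw [norm_smul, Real.norm_eq_abs, abs_of_nonneg hLm0]; exact mul_le_mul_of_nonneg_left (hXt μ b) hLm0
  have hleg : ∀ μ, ‖legProd (L ^ k) M (fun μ b => ((L ^ m : ℕ) : ℝ) • Xt μ b) y (hdig L k m a') μ ν - 1‖ ≤ 2 := fun μ =>
    (norm_legProd_sub_one_le (L ^ k) M (mul_nonneg hLm0 hρ) hρc y _ μ ν).trans (by
      have : Real.exp (((L ^ m : ℕ) : ℝ) * ρ * (L ^ k : ℕ)) ≤ 3 := by
        rw [show ((L ^ m : ℕ) : ℝ) * ρ * (L ^ k : ℕ) = ρ * ((L ^ m * L ^ k : ℕ) : ℝ) by push_cast; ring]; exact he1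
      linarith)
  have key := norm_oprod_sub_oprod_le (κ := 2) zero_le_two (N := d + 1)
    (F := fun i => if h : i < d + 1 then legProd (L ^ m * L ^ k) M X' y a' ⟨i, h⟩ ν else 1)
    (G := fun i => if h : i < d + 1 then legProd (L ^ k) M (fun μ b => ((L ^ m : ℕ) : ℝ) • Xt μ b) y (hdig L k m a') ⟨i, h⟩ ν else 1)
    (fun i hi => by simp only [dif_pos hi]; exact hleg' _) (fun i hi => by simp only [dif_pos hi]; exact hleg _)
  unfold stairProd
  refine key.trans ?_
  have hsum : ∑ i ∈ Finset.range (d + 1),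
      ‖(if h : i < d + 1 then legProd (L ^ m * L ^ k) M X' y a' ⟨i, h⟩ ν else 1) -
        (if h : i < d + 1 then legProd (L ^ k) M (fun μ b => ((L ^ m : ℕ) : ℝ) • Xt μ b) y (hdig L k m a') ⟨i, h⟩ ν else 1)‖ ≤
      (d + 1) * (36 * ((L ^ m * L ^ k : ℕ) : ℝ) * ω + 9 * (((L ^ m : ℕ) : ℝ) * ρ)) := by
    calc _ ≤ ∑ _i ∈ Finset.range (d + 1), (36 * ((L ^ m * L ^ k : ℕ) : ℝ) * ω + 9 * (((L ^ m : ℕ) : ℝ) * ρ)) :=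
          Finset.sum_le_sum fun i hi => by
            rw [Finset.mem_range] at hi
            simp only [dif_pos hi]
            exact norm_legProd_two_spacing_le L k m M hρ hω hρn hX' hXt hfit y a' _ ν
      _ = (d + 1) * (36 * ((L ^ m * L ^ k : ℕ) : ℝ) * ω + 9 * (((L ^ m : ℕ) : ℝ) * ρ)) := by
          rw [Finset.sum_const, Finset.card_range, nsmul_eq_mul]; push_cast; ring
  have hc0 : 0 ≤ (d + 1 : ℝ) * (36 * ((L ^ m * L ^ k : ℕ) : ℝ) * ω + 9 * (((L ^ m : ℕ) : ℝ) * ρ)) := by positivity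
  calc _ ≤ ((d + 1 : ℝ) * (36 * ((L ^ m * L ^ k : ℕ) : ℝ) * ω + 9 * (((L ^ m : ℕ) : ℝ) * ρ))) * (1 + 2) ^ (d + 1) :=
        mul_le_mul_of_nonneg_right hsum (by positivity)
    _ = 3 ^ (d + 1) * ((d + 1) * (36 * ((L ^ m * L ^ k : ℕ) : ℝ) * ω + 9 * (((L ^ m : ℕ) : ℝ) * ρ))) := by norm_num; ring

end TwoSpacings

end Summit.QuantumFields.YangMills.BalabanUVNodes.N15.VectorPiece

end
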